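import Mathlib
import HarnessLib

/-!
# `ArmDressing.EvenPatternDecoupling` — stub `stub_hybridRatioChain` (PROVED)
(route `ArmDressing`, crux item stmt-CriticalPhenomena-16133, line `registered`)

A purely measure-theoretic hybrid (telescoping) lemma used to glue Kesten's SINGLE-ball
ratio-mixing estimate `[K]` into the joint `n`-ball total-variation mixing `[M']` of the
even-pattern decoupling for critical FK-Ising on `ℤ³`.

Setting: `μ` a finite measure on `Ω`; for each ball index `k : Fin n` two events `A k ⊆ B k`
("point arm at ball `k`" inside "ball arm at ball `k`"); a predicate `Far k F` ("`F` is determined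
far from ball `k`") which holds for `E`, for `univ`, for the arms `A j`, `B j` of the OTHER balls
`j ≠ k`, and is stable under binary intersections; and the single-ball hypothesis
`μ(F ∩ A k) · μ(F' ∩ B k) ≤ (1 + ε) · μ(F' ∩ A k) · μ(F ∩ B k)` for all far events `F, F'`
(the ratio `μ(F ∩ A k) / μ(F ∩ B k)` is `(1+ε)`-independent of the far event `F`).

Conclusion: if `μ(⋂ A k) > 0` then the conditional probabilities of `E` given all point arms and
given all ball arms differ by at most `(1 + ε)^n - 1`.

Proof (hybrid argument). Put `M i := ⋂ k, (if k < i then B k else A k)` (`i : ℕ`), so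
`M 0 = ⋂ A k`, `M n = ⋂ B k`, and every `M i ⊇ ⋂ A k` has positive mass. For `i < n` and
`k = ⟨i, _⟩` one has `M i = A k ∩ R`, `M (i+1) = B k ∩ R` with the far event
`R = ⋂_{j ≠ k} (…)`, so the single-ball hypothesis at `(E ∩ R, R)` and at `(R, E ∩ R)` gives, for
`ρ i := μ(E ∩ M i) / μ(M i) ∈ [0, 1]`, the two-sided step `ρ i ≤ (1+ε) ρ (i+1)`,
`ρ (i+1) ≤ (1+ε) ρ i`; chaining, `ρ 0 ≤ (1+ε)^n ρ n` and `ρ n ≤ (1+ε)^n ρ 0`, whence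
`|ρ 0 - ρ n| ≤ ((1+ε)^n - 1) · max (ρ 0) (ρ n) ≤ (1+ε)^n - 1`.

Mathlib only (measure-real API and real arithmetic); no definitions, no named facts, no `sorry`.
-/

namespace Summit.CriticalPhenomena.Ising3DConformalLimit.Theorems.EvenPatternDecoupling

open MeasureTheory Set

/-! ### Elementary set / order lemmas -/

/-- A predicate on sets holding for `univ` and stable under binary intersections holds for every
finite indexed intersection of sets satisfying it. -/
theorem hybridRatioChain_pred_iInter {Ω ι : Type*} [Fintype ι] (P : Set Ω → Prop)
    (huniv : P Set.univ) (hinter : ∀ F G, P F → P G → P (F ∩ G)) (S : ι → Set Ω)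
    (hS : ∀ j, P (S j)) : P (⋂ j, S j) := by
  classical
  have key : ∀ s : Finset ι, P (⋂ j ∈ s, S j) := by
    intro s
    induction s using Finset.induction_on with
    | empty => simpa using huniv
    | insert a s _ ih =>
      rw [Finset.set_biInter_insert]
      exact hinter _ _ (hS a) ih
  simpa using key Finset.univ

/-- Splitting off one factor of a finite intersection: `⋂ j, T j = T k ∩ ⋂ j, (univ if j = k,
else T j)`. -/
theorem hybridRatioChain_iInter_eq_inter {Ω ι : Type*} [DecidableEq ι] (T : ι → Set Ω) (k : ι) :
    (⋂ j, T j) = T k ∩ ⋂ j, (if j = k then Set.univ else T j) := by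
  ext x
  simp only [Set.mem_iInter, Set.mem_inter_iff]
  constructor
  · intro h
    refine ⟨h k, fun j => ?_⟩
    split_ifs
    · exact Set.mem_univ x
    · exact h j
  · rintro ⟨hk, h⟩ j
    by_cases hj : j = k
    · subst hj
      exact hk
    · simpa [hj] using h j

/-- The elementary ratio step: `a d ≤ t (b c)` with `b, d > 0` gives `a / b ≤ t (c / d)`. -/
theorem hybridRatioChain_div_step {a b c d t : ℝ} (hb : 0 < b) (hd : 0 < d)
    (h : a * d ≤ t * (b * c)) : a / b ≤ t * (c / d) := by
  rw [div_le_iff₀ hb, show t * (c / d) * b = t * (b * c) / d by ring, le_div_iff₀ hd]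
  exact h

/-- The final elementary estimate: two numbers `≤ 1`, each at most `P` times the other with
`1 ≤ P`, differ by at most `P - 1`. -/
theorem hybridRatioChain_abs_sub_le {x y P : ℝ} (hx1 : x ≤ 1) (hy1 : y ≤ 1) (hP : 1 ≤ P)
    (hxy : x ≤ P * y) (hyx : y ≤ P * x) : |x - y| ≤ P - 1 := by
  rw [abs_sub_le_iff]
  constructor
  · nlinarith [mul_nonneg (sub_nonneg.2 hP) (sub_nonneg.2 hy1)]
  · nlinarith [mul_nonneg (sub_nonneg.2 hP) (sub_nonneg.2 hx1)]

/-! ### The stub -/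

/-- stub `stub_hybridRatioChain` of the line skeleton of `ArmDressing.EvenPatternDecoupling`
(line `registered`), PROVED: **the hybrid (telescoping) ratio chain over `n` balls.** For a finite
measure `μ`, nested events `A k ⊆ B k` (`k : Fin n`), a "far from ball `k`" predicate `Far k`
containing `E`, `univ`, the other balls' arms and stable under `∩`, and the single-ball
ratio-mixing hypothesis `μ(F ∩ A k) μ(F' ∩ B k) ≤ (1+ε) μ(F' ∩ A k) μ(F ∩ B k)` for far `F, F'`:
if `μ(⋂ A k) > 0` then
`|μ(E ∩ ⋂ A k)/μ(⋂ A k) - μ(E ∩ ⋂ B k)/μ(⋂ B k)| ≤ (1+ε)^n - 1`.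
Proof: hybrids `M i = ⋂ k, (B k if k < i else A k)`, one application of the hypothesis in each
direction per step, and chaining of the ratios `μ(E ∩ M i)/μ(M i) ∈ [0,1]`. -/
theorem stub_hybridRatioChain : ∀ {Ω : Type} [MeasurableSpace Ω] (μ : MeasureTheory.Measure Ω) [MeasureTheory.IsFiniteMeasure μ] (n : ℕ) (A B : Fin n→Set Ω) (E : Set Ω) (Far : Fin n→Set Ω→Prop) (ε : ℝ), 0 ≤ ε→(∀ k, A k ⊆ B k)→(∀ k, Far k E)→(∀ k, Far k Set.univ)→(∀ k j, j ≠ k→Far k (A j))→(∀ k j, j ≠ k→Far k (B j))→(∀ k F G, Far k F→Far k G→Far k (F ∩ G))→(∀ k F F', Far k F→Far k F'→μ.real (F ∩ A k) * μ.real (F' ∩ B k) ≤ (1 + ε) * (μ.real (F' ∩ A k) * μ.real (F ∩ B k)))→0 < μ.real (⋂ k, A k)→|μ.real (E ∩ ⋂ k, A k) / μ.real (⋂ k, A k) - μ.real (E ∩ ⋂ k, B k) / μ.real (⋂ k, B k)| ≤ (1 + ε) ^ n - 1 := by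
  intro Ω _ μ _ n A B E Far ε hε hAB hE huniv hfA hfB hinter hK hpos
  -- the hybrid factors and the hybrid events
  obtain ⟨S, hS⟩ : ∃ S : ℕ → Fin n → Set Ω,
      S = fun (i : ℕ) (j : Fin n) => if (j : ℕ) < i then B j else A j := ⟨_, rfl⟩
  obtain ⟨M, hM⟩ : ∃ M : ℕ → Set Ω, M = fun i : ℕ => ⋂ j, S i j := ⟨_, rfl⟩
  have hM0 : M 0 = ⋂ k, A k := by simp [hM, hS]
  have hMn : M n = ⋂ k, B k := by simp [hM, hS]
  have hAM : ∀ i, (⋂ k, A k) ⊆ M i := by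
    intro i
    rw [hM]
    refine Set.iInter_mono fun k => ?_
    simp only [hS]
    split_ifs
    · exact hAB k
    · exact le_rfl
  have hMpos : ∀ i, 0 < μ.real (M i) := fun i =>
    lt_of_lt_of_le hpos (measureReal_mono (hAM i))
  -- the ratios
  obtain ⟨ρ, hρ⟩ : ∃ ρ : ℕ → ℝ, ρ = fun i : ℕ => μ.real (E ∩ M i) / μ.real (M i) := ⟨_, rfl⟩
  have hρ1 : ∀ i, ρ i ≤ 1 := fun i => by
    rw [hρ]
    exact div_le_one_of_le₀ (measureReal_mono Set.inter_subset_right) measureReal_nonneg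
  -- one hybrid step
  have hstep : ∀ i, i < n → ρ i ≤ (1 + ε) * ρ (i + 1) ∧ ρ (i + 1) ≤ (1 + ε) * ρ i := by
    intro i hi
    set k : Fin n := ⟨i, hi⟩ with hk
    -- the common far factor
    set R : Set Ω := ⋂ j, (if j = k then Set.univ else S i j) with hR
    have hSk : S i k = A k := by simp [hS, hk]
    have hSk' : S (i + 1) k = B k := by simp [hS, hk]
    have hSj : ∀ j, j ≠ k → S (i + 1) j = S i j := by
      intro j hj
      have hji : (j : ℕ) ≠ i := fun h => hj (Fin.ext h)
      have hiff : ((j : ℕ) < i + 1) ↔ ((j : ℕ) < i) := ⟨fun h => by omega, fun h => by omega⟩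
      simp only [hS, hiff]
    have hMi : M i = A k ∩ R := by
      rw [hM, ← hSk]
      exact hybridRatioChain_iInter_eq_inter (S i) k
    have hMi' : M (i + 1) = B k ∩ R := by
      rw [hM, ← hSk']
      refine (hybridRatioChain_iInter_eq_inter (S (i + 1)) k).trans ?_
      congr 1
      refine Set.iInter_congr fun j => ?_
      by_cases hj : j = k
      · simp [hj]
      · simp [hj, hSj j hj]
    have hfarR : Far k R := by
      refine hybridRatioChain_pred_iInter (Far k) (huniv k) (hinter k) _ fun j => ?_
      by_cases hj : j = k
      · simpa [hj] using huniv k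
      · simp only [hj, if_false, hS]
        split_ifs
        · exact hfB k j hj
        · exact hfA k j hj
    have hfarER : Far k (E ∩ R) := hinter k E R (hE k) hfarR
    have e1 : R ∩ A k = M i := by rw [hMi, Set.inter_comm]
    have e2 : E ∩ R ∩ A k = E ∩ M i := by rw [Set.inter_assoc, e1]
    have e3 : R ∩ B k = M (i + 1) := by rw [hMi', Set.inter_comm]
    have e4 : E ∩ R ∩ B k = E ∩ M (i + 1) := by rw [Set.inter_assoc, e3]
    have h1 := hK k (E ∩ R) R hfarER hfarR
    have h2 := hK k R (E ∩ R) hfarR hfarER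
    rw [e1, e2, e3, e4] at h1 h2
    constructor
    · rw [hρ]
      exact hybridRatioChain_div_step (hMpos i) (hMpos (i + 1)) h1
    · rw [hρ]
      refine hybridRatioChain_div_step (hMpos (i + 1)) (hMpos i) ?_
      simpa only [mul_comm] using h2
  -- chaining the steps
  have hε1 : 1 ≤ 1 + ε := by linarith
  have hchain : ∀ i, i ≤ n → ρ 0 ≤ (1 + ε) ^ i * ρ i ∧ ρ i ≤ (1 + ε) ^ i * ρ 0 := by
    intro i
    induction i with
    | zero =>
      intro
      simp
    | succ i ih =>
      intro hi
      have hi' : i < n := hi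
      obtain ⟨ih1, ih2⟩ := ih hi'.le
      obtain ⟨s1, s2⟩ := hstep i hi'
      have hpow : 0 ≤ (1 + ε) ^ i := pow_nonneg (by linarith) i
      constructor
      · calc ρ 0 ≤ (1 + ε) ^ i * ρ i := ih1
          _ ≤ (1 + ε) ^ i * ((1 + ε) * ρ (i + 1)) := mul_le_mul_of_nonneg_left s1 hpow
          _ = (1 + ε) ^ (i + 1) * ρ (i + 1) := by ring
      · calc ρ (i + 1) ≤ (1 + ε) * ρ i := s2
          _ ≤ (1 + ε) * ((1 + ε) ^ i * ρ 0) := mul_le_mul_of_nonneg_left ih2 (by linarith)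
          _ = (1 + ε) ^ (i + 1) * ρ 0 := by ring
  obtain ⟨c1, c2⟩ := hchain n le_rfl
  have hfin := hybridRatioChain_abs_sub_le (hρ1 0) (hρ1 n) (one_le_pow₀ hε1) c1 c2
  rw [← hM0, ← hMn]
  simpa [hρ] using hfin

end Summit.CriticalPhenomena.Ising3DConformalLimit.Theorems.EvenPatternDecoupling
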